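import Literature.Geometry.Kaehler.ComplexTorusComplementaryRestrictedPolarizations
import Literature.Geometry.Kaehler.ComplexTorusKHWeilPairing
import Mathlib.Analysis.Fourier.FiniteAbelian.PontryaginDuality
import HarnessLib

/-!
# Bertrand's Theorem 3 (ii), group-scheme clause: `K(λ)/(B^⊥ ∩ K(λ)) ≃ Hom(B ∩ K(λ), G_m)` — the left
# kernel of `e_λ : K(λ) × (K(λ) ∩ B) → μ` is `K(λ) ∩ B^⊥` (complex tori, any polarisation)

Layer `Literature/Geometry/Kaehler`, namespace `Literature.Geometry.Kaehler.ComplexTorus`; lane `lit-hodgefound`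
(Track 2 foundations library, Layer A2), prover seat `lit-hodgefound-p09` (generation 15, self-proposed row g15-#2).
Sequel of `ComplexTorusComplementaryRestrictedPolarizations.lean` (Lange–Rodríguez 2022 §2.6.2: (2.14), (2.17) and
Thm. 2.6.10 `|K(L)| = |K(L) ∩ B| · |K(L) ∩ P|` — `natCard_kerPhiH_eq_mul_of_isCompl`, consumed here by name), of
`ComplexTorusKHWeilPairing.lean` (Lange 2023 §2.7.1: the Weil pairing `ε^L = weilPairing Φ η` on `K(L)`,
Lemma 2.7.1 (i) bimultiplicativity, (ii) non-degeneracy `IsRiemannForm.eq_zero_of_forall_weilPairing_eq_one`) and of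
`ComplexTorusComplementarySubtorusDegrees.lean` (p10: the DEGREE statements of Bertrand's Theorem 3 (i), (ii); its
header records that "the group-scheme clause of (ii) (`K(λ)/(B^⊥ ∩ K(λ)) ≃ Hom(B ∩ K(λ), G_m)`) … [is] not treated
here" — it is the subject of this file).

## Source, verbatim

D. Bertrand, *Duality on tori and multiplicative dependence relations*, J. Austral. Math. Soc. (Series A) **62**
(1997) 198–216 [cite: Bertrand1997DualityTori] (held text `paper:doi-10-1017-s1446788700000768`; chunk = PDF page):

* §3 (a) THEOREM 3, p. 212 [p0015 L1–L11]: "Let `(A, λ)` be a polarized abelian variety over a field `k`, and let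
  `B`, `B^⊥` be a pair of orthogonal abelian subvarieties with respect to `λ`. […] (ii) furthermore,
  `K(λ)/(B^⊥ ∩ K(λ))` is isomorphic to `Hom(B ∩ K(λ), G_m)`; in particular, `|K(λ)| = |B ∩ K(λ)|·|B^⊥ ∩ K(λ)|"; its
  proof, p. 213 [p0016 L1–L16]: "[…] In other words, the finite group schemes `K(λ)/(B^⊥ ∩ K(λ))` and `B ∩ K(λ)`
  are Cartier duals, and this concludes the proof of Theorem 3."
* the `e_λ` restatement, p. 213 [p0016 L38–L45]: "Finally, here is another way to state (or prove) Theorem 3, in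
  terms of the `e_λ` pairing of Mumford ([14, Section 20]; over `ℂ`, and in the notation of the beginning of this
  section, `e_λ(x, y)` is given by `exp(−2iπ φ(x′, y′))` for `x′, y′` above points `x, y` in `K(λ)`).  Since `e_λ`
  is non-degenerate on `K(λ)`, it is clear that the induced pairing `e_λ : K(λ) × (K(λ) ∩ B) → μ(k^*)` is right
  exact. Its left kernel contains `K(λ) ∩ B^⊥`, and Theorem 3 (ii) expresses the fact that they coincide."

H. Lange, *Abelian Varieties over the Complex Numbers* (Grundlehren Text Edition, Springer 2023)
[cite: Lange2023AbelianVarietiesComplex], §2.7.1 (2.13) "`ε^L : K(L) × K(L) → ℂ^*`, `ε(v̄, w̄) := e(−2πi Im H(v, w))`",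
Lemma 2.7.1 "(i) … bimultiplicative … (ii) `ε^L` is non-degenerate if `L` is".

## Torus level: dictionary and what is proved

`k = ℂ`; `A = X = E/ΦΛ` (`Λ = ℤ^ι`), a polarisation `λ` is presented by a Riemann form `η = E = Im H`
(`hη : IsRiemannForm Φ η`) with integer Gram matrix `G` (`hG : G.map Int.cast = latticeGram Φ η`);
`K(λ) = kerPhiH Φ G`; `e_λ = ε^L = weilPairing Φ η` (the tree's sign: `e(−2πi E(x′, y′))`); a pair of orthogonal
abelian subvarieties is `B = π(V)`, `B^⊥ = π(W)` (`subtorus Φ V`, `subtorus Φ W`) for complementary `E`-orthogonal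
complex lattice subspaces `V ⊕ W = Λ ⊗ ℝ`, `E(V, W) = 0` (symmetric form; the printed `B^⊥` is `W = V^⊥ =
orthSubspace Φ η V`, §5); `G_m(ℂ) = ℂ^*` and `Hom(T, ℂ^*)` of a finite group `T` is Mathlib's Pontryagin dual
`AddChar T ℂ` (a character with values in `ℂ` takes values in `ℂ^*`; `AddChar.card_eq : |T̂| = |T|`).  Over `ℂ` the
finite group scheme `K(λ)` is reduced, so "Cartier dual" is the character group of the group of points.

* §1 `weilPairing_eq_one_of_mem_subtorus_of_orth` (and the mirror `…'`): **`ε^λ(K(λ) ∩ B, K(λ) ∩ B^⊥) = 1`** —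
  "its left kernel contains `K(λ) ∩ B^⊥`" (`ε^λ(π v, π w) = e(−2πi E(v, w)) = 1` for `v ∈ V ⟂ w ∈ W`).
* §2 `weilChar`, **`weilCharHom : S →+ AddChar T ℂ`** (`s ↦ ε^L(s, ·)|_T` for subgroups `S, T ⊆ K(L)`),
  `mem_ker_weilCharHom_iff`; **`IsRiemannForm.weilCharHom_surjective`** — "the induced pairing
  `e_λ : K(λ) × (K(λ) ∩ B) → μ` is right exact": for EVERY subgroup `T ⊆ K(L)` the map `K(L) → T̂` is onto (its
  image separates the points of `T` by Lemma 2.7.1 (ii), and a point-separating subgroup `H ⊆ T̂` of the character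
  group of a finite abelian group is all of `T̂` — the evaluation `T ↪ Ĥ` gives `|T| ≤ |Ĥ| = |H| ≤ |T̂| = |T|`;
  a private lemma); `IsRiemannForm.natCard_ker_weilCharHom_mul` (`|left kernel| · |T| = |K(L)|`) and the trivial
  right kernel `IsRiemannForm.eq_zero_of_forall_weilPairing_eq_one_right`.
* §3 **`IsRiemannForm.ker_weilCharHom_eq_of_isCompl` — THEOREM 3 (ii) in `e_λ` form: the left kernel of
  `e_λ : K(λ) × (K(λ) ∩ B) → μ` IS `K(λ) ∩ B^⊥`** (PROOF as printed: it contains `K(λ) ∩ B^⊥` (§1), has index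
  `|K(λ) ∩ B|` (§2), and `|K(λ)| = |K(λ) ∩ B| · |K(λ) ∩ B^⊥|` (Thm. 2.6.10 of the tree) — "Theorem 3 (ii) expresses
  the fact that they coincide"); pointwise `IsRiemannForm.forall_weilPairing_eq_one_iff_mem_subtorus` (for
  `s ∈ K(λ)`: `ε^λ(s, K(λ) ∩ B) = 1 ↔ s ∈ B^⊥`) and its mirror `…'` (`V ↔ W`);
  `IsRiemannForm.eq_zero_of_mem_inf_subtorus_of_forall_weilPairing_eq_one` (right kernel `0`).
* §4 **`IsRiemannForm.kerPhiHQuotientInfEquivAddChar : K(λ) ⧸ (K(λ) ∩ B^⊥) ≃+ AddChar (K(λ) ∩ B) ℂ` — THEOREM 3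
  (ii): `K(λ)/(B^⊥ ∩ K(λ)) ≃ Hom(B ∩ K(λ), G_m)`**, induced by `e_λ` (`…_apply_mk : [s] ↦ ε^λ(s, ·)`), and the
  count `IsRiemannForm.natCard_kerPhiH_quotient_inf_eq` (`|K(λ)/(K(λ) ∩ B^⊥)| = |K(λ) ∩ B|`).
* §5 the printed `B^⊥ = π(V^⊥)`: `IsRiemannForm.forall_weilPairing_eq_one_iff_mem_subtorus_orthSubspace`,
  `IsRiemannForm.forall_weilPairing_orthSubspace_eq_one_iff_mem_subtorus`,
  `IsRiemannForm.kerPhiHQuotientInfOrthSubspaceEquivAddChar` (+ `_apply_mk`), and "in particular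
  `|K(λ)| = |B ∩ K(λ)| · |B^⊥ ∩ K(λ)|`" re-derived, as printed, from the duality and Lagrange's theorem
  (`IsRiemannForm.natCard_kerPhiH_eq_natCard_inf_mul_natCard_inf_orthSubspace`; the tree's `natCard_kerPhiH_eq_mul`
  is the same count obtained from (2.17)).

Definitions with bodies: `weilChar`, `weilCharHom`, `IsRiemannForm.kerPhiHQuotientInfEquivAddChar`,
`IsRiemannForm.kerPhiHQuotientInfOrthSubspaceEquivAddChar`.  No named fact (net debt 0).  NOT treated: Mumford's
algebraic `e_λ` through the theta group `𝒢(L)` and a scheme structure on `K(λ)` (characteristic `p`); the degree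
statements of Theorem 3 (p10's `ComplexTorusComplementarySubtorusDegrees`).

## References

* [Bertrand1997DualityTori] D. Bertrand, *Duality on tori and multiplicative dependence relations*, J. Austral.
  Math. Soc. Ser. A 62 (1997) 198–216, doi:10.1017/S1446788700000768, §3 (a) Theorem 3 (ii), p. 212, proof and
  the `e_λ` restatement, p. 213 (PDF pp. 15–16).
* [Lange2023AbelianVarietiesComplex] H. Lange, *Abelian Varieties over the Complex Numbers*, Grundlehren Text
  Editions, Springer (2023), §2.7.1 (2.13), Lemma 2.7.1; §1.4.2 Prop. 1.4.7.
* [LangeRodriguez2022] H. Lange, R. E. Rodríguez, *Decomposition of Jacobians by Prym Varieties*, LNM 2310,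
  Springer (2022), §2.6.2 Thm. 2.6.10, p. 37.
* [MumfordAV1970] D. Mumford, *Abelian Varieties*, TIFR Studies in Mathematics 5, OUP (1970), §20 (the pairing
  `e_λ`; Bertrand's reference [14]) — orientation only.
-/

noncomputable section

open Module Function

namespace Literature.Geometry.Kaehler

namespace ComplexTorus

/-! ### §0 A subgroup of the character group separating the points is the whole character group -/

section CharacterGroup

variable {A : Type*} [AddCommGroup A] [Finite A]

/-- For a finite abelian group `A`: a subgroup `H ≤ Â = Hom(A, ℂ^*)` whose characters separate the points of
`A` is all of `Â` — the evaluation map `A → Ĥ` is injective, so `|A| ≤ |Ĥ| = |H| ≤ |Â| = |A|`. [folklore] -/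
private theorem addSubgroup_addChar_eq_top (H : AddSubgroup (AddChar A ℂ))
    (hH : ∀ a : A, (∀ ψ ∈ H, ψ a = 1) → a = 0) : H = ⊤ := by
  classical
  cases nonempty_fintype A
  -- evaluation `A →+ AddChar H ℂ`
  let ev : A →+ AddChar H ℂ :=
    { toFun := fun a ↦
        { toFun := fun ψ ↦ (ψ : AddChar A ℂ) a
          map_zero_eq_one' := by rw [AddSubgroup.coe_zero, AddChar.zero_apply]
          map_add_eq_mul' := fun ψ χ ↦ by rw [AddSubgroup.coe_add, AddChar.add_apply] }
      map_zero' := by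
        ext ψ
        change (ψ : AddChar A ℂ) 0 = (0 : AddChar H ℂ) ψ
        rw [AddChar.map_zero_eq_one, AddChar.zero_apply]
      map_add' := fun a b ↦ by
        ext ψ
        change (ψ : AddChar A ℂ) (a + b) = _
        rw [AddChar.add_apply, AddChar.map_add_eq_mul]
        rfl }
  have hev : Function.Injective ev := by
    refine (injective_iff_map_eq_zero ev).2 fun a ha ↦ hH a fun ψ hψ ↦ ?_
    have h := DFunLike.congr_fun ha ⟨ψ, hψ⟩
    rwa [AddChar.zero_apply] at h
  have h1 : Nat.card A ≤ Nat.card (AddChar H ℂ) := Nat.card_le_card_of_injective ev hev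
  have h2 : Nat.card (AddChar H ℂ) = Nat.card H := by
    rw [Nat.card_eq_fintype_card, AddChar.card_eq, ← Nat.card_eq_fintype_card]
  have h3 : Nat.card (AddChar A ℂ) = Nat.card A := by
    rw [Nat.card_eq_fintype_card, AddChar.card_eq, ← Nat.card_eq_fintype_card]
  have h4 : Nat.card H ≤ Nat.card (AddChar A ℂ) := AddSubgroup.card_le_card_addGroup H
  exact AddSubgroup.eq_top_of_card_eq H (by omega)

end CharacterGroup

variable {ι : Type*} [Fintype ι] [DecidableEq ι] {E : Type*} [NormedAddCommGroup E] [NormedSpace ℂ E]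
  {Φ : (ι → ℝ) ≃L[ℝ] E} {η : E [⋀^Fin 2]→L[ℝ] ℝ} {G : Matrix ι ι ℤ}

/-! ### §1 `ε^λ(K(λ) ∩ B, K(λ) ∩ B^⊥) = 1`: orthogonal sub-tori meet `K(λ)` in mutually orthogonal subgroups -/

section Isotropy

variable (Φ η) {V W : Submodule ℝ (ι → ℝ)}

/-- **The left kernel of `e_λ : K(λ) × (K(λ) ∩ B) → μ` contains `K(λ) ∩ B^⊥`** (Bertrand: "Its left kernel
contains `K(λ) ∩ B^⊥`"): for `E`-orthogonal real subspaces `V ⟂ W` (`E(V, W) = 0`), a point `s = π(v) ∈ K(L) ∩ π(V)`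
and a point `t = π(w) ∈ K(L) ∩ π(W)` pair to `ε^L(s, t) = e(−2πi E(v, w)) = 1`.
[cite: Bertrand1997DualityTori, §3 (a), p. 213 (the `e_λ` restatement of Thm. 3 (ii))] -/
theorem weilPairing_eq_one_of_mem_subtorus_of_orth (hG : G.map (Int.cast : ℤ → ℝ) = latticeGram Φ η)
    (horth : ∀ v ∈ V, ∀ w ∈ W, η ![Φ v, Φ w] = 0) {s t : ComplexTorus Φ} (hs : s ∈ kerPhiH Φ G)
    (hsV : s ∈ subtorus Φ V) (ht : t ∈ kerPhiH Φ G) (htW : t ∈ subtorus Φ W) : weilPairing Φ η s t = 1 := by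
  obtain ⟨v, hv, rfl⟩ := (mem_subtorus_iff Φ).1 hsV
  obtain ⟨w, hw, rfl⟩ := (mem_subtorus_iff Φ).1 htW
  rw [weilPairing_proj_proj_eq_one_iff Φ η hG hs ht]
  exact ⟨0, by rw [horth v hv w hw, Int.cast_zero]⟩

/-- The same with the two sub-tori interchanged: `ε^L(π(W) ∩ K(L), π(V) ∩ K(L)) = 1` for `E(V, W) = 0`
(`ε^L(t, s) = ε^L(s, t)⁻¹`). [cite: Bertrand1997DualityTori, §3 (a), p. 213] -/
theorem weilPairing_eq_one_of_mem_subtorus_of_orth' (hG : G.map (Int.cast : ℤ → ℝ) = latticeGram Φ η)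
    (horth : ∀ v ∈ V, ∀ w ∈ W, η ![Φ v, Φ w] = 0) {s t : ComplexTorus Φ} (hs : s ∈ kerPhiH Φ G)
    (hsW : s ∈ subtorus Φ W) (ht : t ∈ kerPhiH Φ G) (htV : t ∈ subtorus Φ V) : weilPairing Φ η s t = 1 := by
  rw [weilPairing_swap, weilPairing_eq_one_of_mem_subtorus_of_orth Φ η hG horth ht htV hs hsW, inv_one]

end Isotropy

/-! ### §2 The characters `ε^L(s, ·)|_T` and the homomorphism `S → T̂ = Hom(T, ℂ^*)` for subgroups of `K(L)` -/

section Characters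

variable {S T : AddSubgroup (ComplexTorus Φ)}

variable (Φ η) in
/-- **The character `ε^L(s, ·)|_T ∈ T̂ = Hom(T, ℂ^*)`** of a subgroup `T ⊆ K(L)` defined by a point `s` of a
subgroup `S ⊆ K(L)` (bimultiplicativity of `ε^L` on `K(L)`, Lemma 2.7.1 (i); Mathlib's Pontryagin dual
`AddChar T ℂ`: a character with values in `ℂ` takes values in `ℂ^*`).  Bertrand's induced pairing
`e_λ : K(λ) × (K(λ) ∩ B) → μ` is the case `S = K(λ)`, `T = K(λ) ∩ B`.
[cite: Bertrand1997DualityTori, §3 (a), p. 213] [cite: Lange2023AbelianVarietiesComplex, §2.7.1 Lemma 2.7.1 (i)] -/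
def weilChar (hG : G.map (Int.cast : ℤ → ℝ) = latticeGram Φ η) (hS : S ≤ kerPhiH Φ G) (hT : T ≤ kerPhiH Φ G)
    (s : S) : AddChar T ℂ where
  toFun t := weilPairing Φ η (s : ComplexTorus Φ) (t : ComplexTorus Φ)
  map_zero_eq_one' := by
    rw [ZeroMemClass.coe_zero]
    exact weilPairing_zero_right Φ η hG (hS s.2)
  map_add_eq_mul' t₁ t₂ := by
    rw [AddMemClass.coe_add]
    exact weilPairing_add_right Φ η hG (hS s.2) (hT t₁.2) (hT t₂.2)

variable (Φ η) in
/-- `weilChar … s t = ε^L(s, t)`. [cite: Bertrand1997DualityTori, §3 (a), p. 213] -/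
@[simp] theorem weilChar_apply (hG : G.map (Int.cast : ℤ → ℝ) = latticeGram Φ η) (hS : S ≤ kerPhiH Φ G)
    (hT : T ≤ kerPhiH Φ G) (s : S) (t : T) :
    weilChar Φ η hG hS hT s t = weilPairing Φ η (s : ComplexTorus Φ) (t : ComplexTorus Φ) := rfl

variable (Φ η) in
/-- **The homomorphism `S → T̂`, `s ↦ ε^L(s, ·)|_T`** (the group law of `AddChar T ℂ` is pointwise
multiplication; bimultiplicativity in the first slot).  For `S = K(λ)`, `T = K(λ) ∩ B` this is the map whose
kernel is the left kernel of Bertrand's `e_λ : K(λ) × (K(λ) ∩ B) → μ`.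
[cite: Bertrand1997DualityTori, §3 (a), p. 213] [cite: Lange2023AbelianVarietiesComplex, §2.7.1 Lemma 2.7.1 (i)] -/
def weilCharHom (hG : G.map (Int.cast : ℤ → ℝ) = latticeGram Φ η) (hS : S ≤ kerPhiH Φ G) (hT : T ≤ kerPhiH Φ G) :
    S →+ AddChar T ℂ where
  toFun := weilChar Φ η hG hS hT
  map_zero' := by
    ext t
    rw [weilChar_apply, AddChar.zero_apply, ZeroMemClass.coe_zero]
    exact weilPairing_zero_left Φ η hG (hT t.2)
  map_add' s₁ s₂ := by
    ext t
    rw [AddChar.add_apply, weilChar_apply, weilChar_apply, weilChar_apply, AddMemClass.coe_add]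
    exact weilPairing_add_left Φ η hG (hS s₁.2) (hS s₂.2) (hT t.2)

variable (Φ η) in
/-- `weilCharHom … s t = ε^L(s, t)`. [cite: Bertrand1997DualityTori, §3 (a), p. 213] -/
@[simp] theorem weilCharHom_apply (hG : G.map (Int.cast : ℤ → ℝ) = latticeGram Φ η) (hS : S ≤ kerPhiH Φ G)
    (hT : T ≤ kerPhiH Φ G) (s : S) (t : T) :
    weilCharHom Φ η hG hS hT s t = weilPairing Φ η (s : ComplexTorus Φ) (t : ComplexTorus Φ) := rfl

variable (Φ η) in
/-- The kernel of `S → T̂` is the left kernel `{s ∈ S ∣ ε^L(s, T) = 1}` of `ε^L|_{S × T}`.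
[cite: Bertrand1997DualityTori, §3 (a), p. 213] -/
theorem mem_ker_weilCharHom_iff (hG : G.map (Int.cast : ℤ → ℝ) = latticeGram Φ η) (hS : S ≤ kerPhiH Φ G)
    (hT : T ≤ kerPhiH Φ G) (s : S) :
    s ∈ (weilCharHom Φ η hG hS hT).ker ↔
      ∀ t ∈ T, weilPairing Φ η (s : ComplexTorus Φ) t = 1 := by
  rw [AddMonoidHom.mem_ker]
  constructor
  · intro h t ht
    have h' := DFunLike.congr_fun h ⟨t, ht⟩
    rwa [weilCharHom_apply, AddChar.zero_apply] at h'
  · intro h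
    ext t
    rw [weilCharHom_apply, AddChar.zero_apply]
    exact h t t.2

/-- **"Since `e_λ` is non-degenerate on `K(λ)`, the induced pairing `e_λ : K(λ) × (K(λ) ∩ B) → μ` is right
exact"**: for a polarisation and ANY subgroup `T ⊆ K(L)`, every character of `T` is `ε^L(s, ·)|_T` for some
`s ∈ K(L)` — the homomorphism `K(L) → T̂` is onto (its image separates the points of `T` by the
non-degeneracy of `ε^L` on `K(L)`, Lemma 2.7.1 (ii), and a separating subgroup of `T̂` is `T̂`).
[cite: Bertrand1997DualityTori, §3 (a), p. 213] [cite: Lange2023AbelianVarietiesComplex, §2.7.1 Lemma 2.7.1 (ii)] -/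
theorem IsRiemannForm.weilCharHom_surjective
    (hη : IsRiemannForm Φ η) (hG : G.map (Int.cast : ℤ → ℝ) = latticeGram Φ η) (hT : T ≤ kerPhiH Φ G) :
    Function.Surjective (weilCharHom Φ η hG (le_refl (kerPhiH Φ G)) hT) := by
  haveI : Finite (kerPhiH Φ G) := hη.finite_kerPhiH hG
  haveI : Finite T := Finite.of_injective _ (AddSubgroup.inclusion_injective hT)
  rw [← AddMonoidHom.range_eq_top]
  refine addSubgroup_addChar_eq_top _ fun t h ↦ ?_
  have h0 : (t : ComplexTorus Φ) = 0 := by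
    refine hη.eq_zero_of_forall_weilPairing_eq_one hG (hT t.2) fun s hs ↦ ?_
    have h1 : weilPairing Φ η s (t : ComplexTorus Φ) = 1 := h _ ⟨⟨s, hs⟩, rfl⟩
    rw [weilPairing_swap, h1, inv_one]
  exact Subtype.ext h0

/-- **`|left kernel| · |T| = |K(L)|`**: for a polarisation and a subgroup `T ⊆ K(L)`, the left kernel
`N = {s ∈ K(L) ∣ ε^L(s, T) = 1}` of `ε^L|_{K(L) × T}` has index `|T|` (`K(L)/N ≃ T̂` and `|T̂| = |T|`).
[cite: Bertrand1997DualityTori, §3 (a), p. 213] -/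
theorem IsRiemannForm.natCard_ker_weilCharHom_mul
    (hη : IsRiemannForm Φ η) (hG : G.map (Int.cast : ℤ → ℝ) = latticeGram Φ η) (hT : T ≤ kerPhiH Φ G) :
    Nat.card (weilCharHom Φ η hG (le_refl (kerPhiH Φ G)) hT).ker * Nat.card T = Nat.card (kerPhiH Φ G) := by
  haveI : Finite (kerPhiH Φ G) := hη.finite_kerPhiH hG
  haveI : Finite T := Finite.of_injective _ (AddSubgroup.inclusion_injective hT)
  set ψ := weilCharHom Φ η hG (le_refl (kerPhiH Φ G)) hT with hψ
  have h1 : Nat.card (↥(kerPhiH Φ G) ⧸ ψ.ker) = Nat.card (AddChar T ℂ) :=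
    Nat.card_congr (QuotientAddGroup.quotientKerEquivOfSurjective ψ (hη.weilCharHom_surjective hG hT)).toEquiv
  have h2 : Nat.card (AddChar T ℂ) = Nat.card T := by
    letI := Fintype.ofFinite T
    rw [Nat.card_eq_fintype_card, AddChar.card_eq, ← Nat.card_eq_fintype_card]
  rw [AddSubgroup.card_eq_card_quotient_mul_card_addSubgroup ψ.ker, h1, h2, mul_comm]

/-- The right kernel of `ε^L|_{K(L) × T}` is trivial: a point `t ∈ T ⊆ K(L)` with `ε^L(K(L), t) = 1` is `0`
(non-degeneracy of `ε^L` on `K(L)`). [cite: Lange2023AbelianVarietiesComplex, §2.7.1 Lemma 2.7.1 (ii)]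
[cite: Bertrand1997DualityTori, §3 (a), p. 213 ("Since `e_λ` is non-degenerate on `K(λ)` …")] -/
theorem IsRiemannForm.eq_zero_of_forall_weilPairing_eq_one_right
    (hη : IsRiemannForm Φ η) (hG : G.map (Int.cast : ℤ → ℝ) = latticeGram Φ η)
    {t : ComplexTorus Φ} (ht : t ∈ kerPhiH Φ G) (h : ∀ s ∈ kerPhiH Φ G, weilPairing Φ η s t = 1) : t = 0 :=
  hη.eq_zero_of_forall_weilPairing_eq_one hG ht fun s hs ↦ by rw [weilPairing_swap, h s hs, inv_one]

end Characters

/-! ### §3 Theorem 3 (ii), `e_λ` form: the left kernel of `e_λ : K(λ) × (K(λ) ∩ B) → μ` is `K(λ) ∩ B^⊥` -/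

section LeftKernel

variable {V W : Submodule ℝ (ι → ℝ)}

/-- **THEOREM 3 (ii) in terms of `e_λ` (Bertrand, p. 213): the left kernel of the induced pairing
`e_λ : K(λ) × (K(λ) ∩ B) → μ` is exactly `K(λ) ∩ B^⊥`.**  Torus level, symmetric form: `X = E/ΦΛ` with a
polarisation `η` (integer Gram matrix `G`, `K(λ) = kerPhiH Φ G`), `B = π(V)`, `B^⊥ = π(W)` a pair of
complementary `E`-orthogonal complex sub-tori (`Λ ⊗ ℝ = V ⊕ W`, `E(V, W) = 0`).  PROOF as indicated there
("Its left kernel contains `K(λ) ∩ B^⊥`, and Theorem 3 (ii) expresses the fact that they coincide"): the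
kernel `N` contains `K(λ) ∩ B^⊥` (§1), has index `|K(λ) ∩ B|` because the pairing is right exact (§2), and
`|K(λ)| = |K(λ) ∩ B| · |K(λ) ∩ B^⊥|` (the tree's `natCard_kerPhiH_eq_mul_of_isCompl`, Lange–Rodríguez
Thm. 2.6.10), so the inclusion is an equality of finite groups.
[cite: Bertrand1997DualityTori, §3 (a) Thm. 3 (ii) and p. 213] [cite: LangeRodriguez2022, §2.6.2 Thm. 2.6.10, p. 37] -/
theorem IsRiemannForm.ker_weilCharHom_eq_of_isCompl
    (hη : IsRiemannForm Φ η) (hG : G.map (Int.cast : ℤ → ℝ) = latticeGram Φ η) (hV : IsLatticeSubspace V)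
    (hVc : IsComplexSubspace Φ V) (hW : IsLatticeSubspace W) (hWc : IsComplexSubspace Φ W) (hVW : IsCompl V W)
    (horth : ∀ v ∈ V, ∀ w ∈ W, η ![Φ v, Φ w] = 0) :
    (weilCharHom Φ η hG (le_refl (kerPhiH Φ G)) (inf_le_left : kerPhiH Φ G ⊓ subtorus Φ V ≤ kerPhiH Φ G)).ker =
      (kerPhiH Φ G ⊓ subtorus Φ W).addSubgroupOf (kerPhiH Φ G) := by
  haveI : Finite (kerPhiH Φ G) := hη.finite_kerPhiH hG
  set ψ := weilCharHom Φ η hG (le_refl (kerPhiH Φ G))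
    (inf_le_left : kerPhiH Φ G ⊓ subtorus Φ V ≤ kerPhiH Φ G) with hψ
  -- `K(λ) ∩ B^⊥ ⊆ N`
  have hle : (kerPhiH Φ G ⊓ subtorus Φ W).addSubgroupOf (kerPhiH Φ G) ≤ ψ.ker := by
    intro s hs
    rw [AddSubgroup.mem_addSubgroupOf] at hs
    rw [hψ, mem_ker_weilCharHom_iff]
    intro t ht
    exact weilPairing_eq_one_of_mem_subtorus_of_orth' Φ η hG horth s.2 (AddSubgroup.mem_inf.1 hs).2
      (AddSubgroup.mem_inf.1 ht).1 (AddSubgroup.mem_inf.1 ht).2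
  -- the two counts
  have hcount := hη.natCard_ker_weilCharHom_mul hG (inf_le_left : kerPhiH Φ G ⊓ subtorus Φ V ≤ kerPhiH Φ G)
  rw [natCard_kerPhiH_eq_mul_of_isCompl Φ hη hG hV hVc hW hWc hVW horth, mul_comm] at hcount
  have hpos : 0 < Nat.card ↥(kerPhiH Φ G ⊓ subtorus Φ V) := by
    haveI : Finite ↥(kerPhiH Φ G ⊓ subtorus Φ V) :=
      Finite.of_injective _ (AddSubgroup.inclusion_injective (inf_le_left : kerPhiH Φ G ⊓ subtorus Φ V ≤ _))
    exact Nat.card_pos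
  have hcard : Nat.card ψ.ker = Nat.card ↥(kerPhiH Φ G ⊓ subtorus Φ W) := Nat.eq_of_mul_eq_mul_left hpos hcount
  have hcard' : Nat.card ↥((kerPhiH Φ G ⊓ subtorus Φ W).addSubgroupOf (kerPhiH Φ G)) =
      Nat.card ↥(kerPhiH Φ G ⊓ subtorus Φ W) :=
    Nat.card_congr (AddSubgroup.addSubgroupOfEquivOfLe (inf_le_left : kerPhiH Φ G ⊓ subtorus Φ W ≤ _)).toEquiv
  exact (AddSubgroup.eq_of_le_of_card_ge hle (by rw [hcard, hcard'])).symm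

/-- **THEOREM 3 (ii), `e_λ` form, pointwise**: for `s ∈ K(λ)`, `ε^λ(s, t) = 1` for all `t ∈ K(λ) ∩ B` iff
`s ∈ B^⊥` (complementary `E`-orthogonal complex sub-tori `B = π(V)`, `B^⊥ = π(W)`).
[cite: Bertrand1997DualityTori, §3 (a) Thm. 3 (ii) and p. 213] -/
theorem IsRiemannForm.forall_weilPairing_eq_one_iff_mem_subtorus
    (hη : IsRiemannForm Φ η) (hG : G.map (Int.cast : ℤ → ℝ) = latticeGram Φ η)
    (hV : IsLatticeSubspace V) (hVc : IsComplexSubspace Φ V) (hW : IsLatticeSubspace W)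
    (hWc : IsComplexSubspace Φ W) (hVW : IsCompl V W) (horth : ∀ v ∈ V, ∀ w ∈ W, η ![Φ v, Φ w] = 0)
    {s : ComplexTorus Φ} (hs : s ∈ kerPhiH Φ G) :
    (∀ t ∈ kerPhiH Φ G ⊓ subtorus Φ V, weilPairing Φ η s t = 1) ↔ s ∈ subtorus Φ W := by
  have h := hη.ker_weilCharHom_eq_of_isCompl hG hV hVc hW hWc hVW horth
  have hmem := mem_ker_weilCharHom_iff Φ η hG (le_refl (kerPhiH Φ G))
    (inf_le_left : kerPhiH Φ G ⊓ subtorus Φ V ≤ kerPhiH Φ G) ⟨s, hs⟩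
  rw [h, AddSubgroup.mem_addSubgroupOf, AddSubgroup.mem_inf] at hmem
  simp only [hs, true_and] at hmem
  exact hmem.symm

/-- The same with `B` and `B^⊥` interchanged: for `s ∈ K(λ)`, `ε^λ(s, t) = 1` for all `t ∈ K(λ) ∩ B^⊥` iff
`s ∈ B` (the hypotheses are symmetric in `V`, `W`). [cite: Bertrand1997DualityTori, §3 (a) Thm. 3 (ii) and p. 213] -/
theorem IsRiemannForm.forall_weilPairing_eq_one_iff_mem_subtorus'
    (hη : IsRiemannForm Φ η) (hG : G.map (Int.cast : ℤ → ℝ) = latticeGram Φ η)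
    (hV : IsLatticeSubspace V) (hVc : IsComplexSubspace Φ V) (hW : IsLatticeSubspace W)
    (hWc : IsComplexSubspace Φ W) (hVW : IsCompl V W) (horth : ∀ v ∈ V, ∀ w ∈ W, η ![Φ v, Φ w] = 0)
    {s : ComplexTorus Φ} (hs : s ∈ kerPhiH Φ G) :
    (∀ t ∈ kerPhiH Φ G ⊓ subtorus Φ W, weilPairing Φ η s t = 1) ↔ s ∈ subtorus Φ V :=
  hη.forall_weilPairing_eq_one_iff_mem_subtorus hG hW hWc hV hVc hVW.symm
    (fun w hw v hv ↦ by rw [twoForm_swap, horth v hv w hw, neg_zero]) hs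

/-- **The right kernel of `e_λ : K(λ) × (K(λ) ∩ B) → μ` is trivial** (`e_λ` is non-degenerate on `K(λ)`).
[cite: Bertrand1997DualityTori, §3 (a), p. 213] -/
theorem IsRiemannForm.eq_zero_of_mem_inf_subtorus_of_forall_weilPairing_eq_one
    (hη : IsRiemannForm Φ η) (hG : G.map (Int.cast : ℤ → ℝ) = latticeGram Φ η)
    {t : ComplexTorus Φ} (ht : t ∈ kerPhiH Φ G ⊓ subtorus Φ V) (h : ∀ s ∈ kerPhiH Φ G, weilPairing Φ η s t = 1) :
    t = 0 :=
  hη.eq_zero_of_forall_weilPairing_eq_one_right hG (AddSubgroup.mem_inf.1 ht).1 h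

end LeftKernel

/-! ### §4 Theorem 3 (ii): `K(λ)/(B^⊥ ∩ K(λ)) ≃ Hom(B ∩ K(λ), G_m)` — the two groups are Cartier duals -/

section CartierDual

variable {V W : Submodule ℝ (ι → ℝ)}

/-- **THEOREM 3 (ii) (Bertrand): `K(λ)/(B^⊥ ∩ K(λ))` is isomorphic to `Hom(B ∩ K(λ), G_m)`** — "the finite
group schemes `K(λ)/(B^⊥ ∩ K(λ))` and `B ∩ K(λ)` are Cartier duals".  Torus level (`k = ℂ`, `G_m(ℂ) = ℂ^*`,
`Hom(·, ℂ^*) =` Mathlib's `AddChar · ℂ`), symmetric form for a pair of complementary `E`-orthogonal complex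
sub-tori `B = π(V)`, `B^⊥ = π(W)` of a polarised torus: the isomorphism induced by `e_λ`, `[s] ↦ ε^λ(s, ·)|_{K(λ) ∩ B}`
(§3: its kernel is `K(λ) ∩ B^⊥`; §2: it is onto).
[cite: Bertrand1997DualityTori, §3 (a) Thm. 3 (ii), p. 212, and its proof, p. 213] -/
def IsRiemannForm.kerPhiHQuotientInfEquivAddChar
    (hη : IsRiemannForm Φ η) (hG : G.map (Int.cast : ℤ → ℝ) = latticeGram Φ η) (hV : IsLatticeSubspace V)
    (hVc : IsComplexSubspace Φ V) (hW : IsLatticeSubspace W) (hWc : IsComplexSubspace Φ W) (hVW : IsCompl V W)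
    (horth : ∀ v ∈ V, ∀ w ∈ W, η ![Φ v, Φ w] = 0) :
    ↥(kerPhiH Φ G) ⧸ (kerPhiH Φ G ⊓ subtorus Φ W).addSubgroupOf (kerPhiH Φ G) ≃+
      AddChar ↥(kerPhiH Φ G ⊓ subtorus Φ V) ℂ :=
  (QuotientAddGroup.quotientAddEquivOfEq (hη.ker_weilCharHom_eq_of_isCompl hG hV hVc hW hWc hVW horth).symm).trans
    (QuotientAddGroup.quotientKerEquivOfSurjective
      (weilCharHom Φ η hG (le_refl (kerPhiH Φ G)) (inf_le_left : kerPhiH Φ G ⊓ subtorus Φ V ≤ kerPhiH Φ G))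
      (hη.weilCharHom_surjective hG inf_le_left))

/-- The isomorphism of Theorem 3 (ii) is induced by `e_λ`: `[s] ↦ (t ↦ ε^λ(s, t))`.
[cite: Bertrand1997DualityTori, §3 (a) Thm. 3 (ii) and p. 213] -/
@[simp] theorem IsRiemannForm.kerPhiHQuotientInfEquivAddChar_apply_mk
    (hη : IsRiemannForm Φ η) (hG : G.map (Int.cast : ℤ → ℝ) = latticeGram Φ η)
    (hV : IsLatticeSubspace V) (hVc : IsComplexSubspace Φ V) (hW : IsLatticeSubspace W)
    (hWc : IsComplexSubspace Φ W) (hVW : IsCompl V W) (horth : ∀ v ∈ V, ∀ w ∈ W, η ![Φ v, Φ w] = 0)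
    (s : kerPhiH Φ G) (t : ↥(kerPhiH Φ G ⊓ subtorus Φ V)) :
    hη.kerPhiHQuotientInfEquivAddChar hG hV hVc hW hWc hVW horth (QuotientAddGroup.mk s) t =
      weilPairing Φ η (s : ComplexTorus Φ) (t : ComplexTorus Φ) := by
  rw [IsRiemannForm.kerPhiHQuotientInfEquivAddChar, AddEquiv.trans_apply, QuotientAddGroup.quotientAddEquivOfEq_mk]
  rfl

/-- **"In particular `|K(λ)| = |B ∩ K(λ)| · |B^⊥ ∩ K(λ)|`"** read through the duality: `|K(λ)/(B^⊥ ∩ K(λ))| =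
|Hom(B ∩ K(λ), ℂ^*)| = |B ∩ K(λ)|`. [cite: Bertrand1997DualityTori, §3 (a) Thm. 3 (ii), p. 212] -/
theorem IsRiemannForm.natCard_kerPhiH_quotient_inf_eq
    (hη : IsRiemannForm Φ η) (hG : G.map (Int.cast : ℤ → ℝ) = latticeGram Φ η) (hV : IsLatticeSubspace V)
    (hVc : IsComplexSubspace Φ V) (hW : IsLatticeSubspace W) (hWc : IsComplexSubspace Φ W) (hVW : IsCompl V W)
    (horth : ∀ v ∈ V, ∀ w ∈ W, η ![Φ v, Φ w] = 0) :
    Nat.card (↥(kerPhiH Φ G) ⧸ (kerPhiH Φ G ⊓ subtorus Φ W).addSubgroupOf (kerPhiH Φ G)) =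
      Nat.card ↥(kerPhiH Φ G ⊓ subtorus Φ V) := by
  haveI : Finite (kerPhiH Φ G) := hη.finite_kerPhiH hG
  haveI : Finite ↥(kerPhiH Φ G ⊓ subtorus Φ V) :=
    Finite.of_injective _ (AddSubgroup.inclusion_injective (inf_le_left : kerPhiH Φ G ⊓ subtorus Φ V ≤ _))
  letI := Fintype.ofFinite ↥(kerPhiH Φ G ⊓ subtorus Φ V)
  rw [Nat.card_congr (hη.kerPhiHQuotientInfEquivAddChar hG hV hVc hW hWc hVW horth).toEquiv,
    Nat.card_eq_fintype_card, AddChar.card_eq, ← Nat.card_eq_fintype_card]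

end CartierDual

/-! ### §5 The printed `B^⊥ = π(V^⊥)`: statements for a complex sub-torus and its orthogonal complement -/

section Printed

variable {V : Submodule ℝ (ι → ℝ)}

/-- **THEOREM 3 (ii), `e_λ` form, for `B = π(V)` and its orthogonal complement `B^⊥ = π(V^⊥)`**
(`V^⊥ = orthSubspace Φ η V`): for `s ∈ K(λ)`, `ε^λ(s, K(λ) ∩ B) = 1 ↔ s ∈ B^⊥`.
[cite: Bertrand1997DualityTori, §3 (a) Thm. 3 (ii) and p. 213] -/
theorem IsRiemannForm.forall_weilPairing_eq_one_iff_mem_subtorus_orthSubspace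
    (hη : IsRiemannForm Φ η) (hG : G.map (Int.cast : ℤ → ℝ) = latticeGram Φ η)
    (hV : IsLatticeSubspace V) (hVc : IsComplexSubspace Φ V) {s : ComplexTorus Φ} (hs : s ∈ kerPhiH Φ G) :
    (∀ t ∈ kerPhiH Φ G ⊓ subtorus Φ V, weilPairing Φ η s t = 1) ↔ s ∈ subtorus Φ (orthSubspace Φ η V) :=
  hη.forall_weilPairing_eq_one_iff_mem_subtorus hG hV hVc (isLatticeSubspace_orthSubspace Φ hη hV hVc)
    (isComplexSubspace_orthSubspace Φ hη.1 hVc) (isCompl_orthSubspace Φ hη hVc)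
    (fun _ hv _ hw ↦ twoForm_eq_zero_of_mem_orthSubspace Φ hv hw) hs

/-- **THEOREM 3 (ii), `e_λ` form, the other side**: for `s ∈ K(λ)`, `ε^λ(s, K(λ) ∩ B^⊥) = 1 ↔ s ∈ B`.
[cite: Bertrand1997DualityTori, §3 (a) Thm. 3 (ii) and p. 213] -/
theorem IsRiemannForm.forall_weilPairing_orthSubspace_eq_one_iff_mem_subtorus
    (hη : IsRiemannForm Φ η) (hG : G.map (Int.cast : ℤ → ℝ) = latticeGram Φ η)
    (hV : IsLatticeSubspace V) (hVc : IsComplexSubspace Φ V) {s : ComplexTorus Φ} (hs : s ∈ kerPhiH Φ G) :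
    (∀ t ∈ kerPhiH Φ G ⊓ subtorus Φ (orthSubspace Φ η V), weilPairing Φ η s t = 1) ↔ s ∈ subtorus Φ V :=
  hη.forall_weilPairing_eq_one_iff_mem_subtorus' hG hV hVc (isLatticeSubspace_orthSubspace Φ hη hV hVc)
    (isComplexSubspace_orthSubspace Φ hη.1 hVc) (isCompl_orthSubspace Φ hη hVc)
    (fun _ hv _ hw ↦ twoForm_eq_zero_of_mem_orthSubspace Φ hv hw) hs

/-- **THEOREM 3 (ii) (Bertrand) for `B = π(V)`, `B^⊥ = π(V^⊥)`: `K(λ)/(B^⊥ ∩ K(λ)) ≃ Hom(B ∩ K(λ), ℂ^*)`,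
induced by `e_λ`.** [cite: Bertrand1997DualityTori, §3 (a) Thm. 3 (ii), p. 212] -/
def IsRiemannForm.kerPhiHQuotientInfOrthSubspaceEquivAddChar
    (hη : IsRiemannForm Φ η) (hG : G.map (Int.cast : ℤ → ℝ) = latticeGram Φ η) (hV : IsLatticeSubspace V)
    (hVc : IsComplexSubspace Φ V) :
    ↥(kerPhiH Φ G) ⧸ (kerPhiH Φ G ⊓ subtorus Φ (orthSubspace Φ η V)).addSubgroupOf (kerPhiH Φ G) ≃+
      AddChar ↥(kerPhiH Φ G ⊓ subtorus Φ V) ℂ :=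
  hη.kerPhiHQuotientInfEquivAddChar hG hV hVc (isLatticeSubspace_orthSubspace Φ hη hV hVc)
    (isComplexSubspace_orthSubspace Φ hη.1 hVc) (isCompl_orthSubspace Φ hη hVc)
    fun _ hv _ hw ↦ twoForm_eq_zero_of_mem_orthSubspace Φ hv hw

/-- The isomorphism for `B^⊥ = π(V^⊥)` is `[s] ↦ ε^λ(s, ·)`. [cite: Bertrand1997DualityTori, §3 (a) Thm. 3 (ii) and p. 213] -/
@[simp] theorem IsRiemannForm.kerPhiHQuotientInfOrthSubspaceEquivAddChar_apply_mk
    (hη : IsRiemannForm Φ η) (hG : G.map (Int.cast : ℤ → ℝ) = latticeGram Φ η)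
    (hV : IsLatticeSubspace V) (hVc : IsComplexSubspace Φ V) (s : kerPhiH Φ G)
    (t : ↥(kerPhiH Φ G ⊓ subtorus Φ V)) :
    hη.kerPhiHQuotientInfOrthSubspaceEquivAddChar hG hV hVc (QuotientAddGroup.mk s) t =
      weilPairing Φ η (s : ComplexTorus Φ) (t : ComplexTorus Φ) :=
  hη.kerPhiHQuotientInfEquivAddChar_apply_mk hG hV hVc _ _ _ _ s t

/-- **"In particular, `|K(λ)| = |B ∩ K(λ)| · |B^⊥ ∩ K(λ)|`"** (Thm. 3 (ii)), here as a consequence of the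
duality `|K(λ)/(B^⊥ ∩ K(λ))| = |B ∩ K(λ)|` and Lagrange (the tree's `natCard_kerPhiH_eq_mul` is the same count
obtained from (2.17); this is the printed deduction). [cite: Bertrand1997DualityTori, §3 (a) Thm. 3 (ii), p. 212] -/
theorem IsRiemannForm.natCard_kerPhiH_eq_natCard_inf_mul_natCard_inf_orthSubspace
    (hη : IsRiemannForm Φ η) (hG : G.map (Int.cast : ℤ → ℝ) = latticeGram Φ η)
    (hV : IsLatticeSubspace V) (hVc : IsComplexSubspace Φ V) :
    Nat.card (kerPhiH Φ G) =
      Nat.card ↥(kerPhiH Φ G ⊓ subtorus Φ V) * Nat.card ↥(kerPhiH Φ G ⊓ subtorus Φ (orthSubspace Φ η V)) := by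
  have h1 := hη.natCard_kerPhiH_quotient_inf_eq hG hV hVc (isLatticeSubspace_orthSubspace Φ hη hV hVc)
    (isComplexSubspace_orthSubspace Φ hη.1 hVc) (isCompl_orthSubspace Φ hη hVc)
    fun _ hv _ hw ↦ twoForm_eq_zero_of_mem_orthSubspace Φ hv hw
  have h2 := AddSubgroup.card_eq_card_quotient_mul_card_addSubgroup
    ((kerPhiH Φ G ⊓ subtorus Φ (orthSubspace Φ η V)).addSubgroupOf (kerPhiH Φ G))
  rw [h1, Nat.card_congr (AddSubgroup.addSubgroupOfEquivOfLe
    (inf_le_left : kerPhiH Φ G ⊓ subtorus Φ (orthSubspace Φ η V) ≤ _)).toEquiv] at h2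
  exact h2

end Printed

end ComplexTorus

end Literature.Geometry.Kaehler
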